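import Mathlib.Analysis.SpecialFunctions.ExpDeriv
import Literature.Analysis.FluidPDE.OnsagerBDSVStationaryPhaseGeometry
import Literature.Analysis.FunctionSpaces.TorusCalculusProofs
import HarnessLib

/-!
# BDSV stationary phase, II: integration by parts along `∇φ/|∇φ|²`

Buckmaster–De Lellis–Székelyhidi–Vicol 2019, App. C, Prop. C.2 (C.1) / Daneri–Székelyhidi 2017,
Lemma 2.2 (i), proof: with `a₀ = a`, `aₙ = -div(aₙ₋₁ ∇φ/|∇φ|²)` one has
`∫ a e^{iλφ} = (iλ)^{-N} ∫ a_N e^{iλφ}` ("it follows by induction on `N`"), whence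
`|∫ a e^{iλφ}| ≤ ‖a_N‖₀ λ^{-N}`. This file carries out exactly this step for the tree's
transcription (`OnsagerBDSVStationaryPhase.lean`): the phase factor is
`E = e^{iθ} e^{2πi m·Φ}` (`BDSV.phaseFactor`, real part `BDSV.phaseCos`), the field is
`F = ∇φ/|∇φ|²` for `φ = 2π m·Φ` (`BDSV.ibpField`, previous file), and the operator is
`L b = ∑ⱼ ∂ⱼ(b Fⱼ) = div(b F)` (`BDSV.ibpOp`; the factor `λ⁻¹ = (2π|m|)⁻¹` is built into `F`,
and the sign into `i`):

* `BDSV.lift_phaseFactor`, `BDSV.partialDeriv_phaseFactor` — `E = exp(iΨ)` on the cover `ℝ³`,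
  `∂ⱼE = i (2π|m| dirVecⱼ) E`;
* `BDSV.integral_mul_phaseFactor` — **one integration by parts**: `∫ b E = i ∫ (L b) E` for smooth
  real `b` (torus, no boundary terms: `Torus.integral_partialDeriv_eq_zero_holds`);
* `BDSV.norm_integral_mul_phaseFactor_eq_iterate` — `‖∫ a E‖ = ‖∫ (Lᴺ a) E‖`;
* `BDSV.norm_integral_phaseCos_mul_le` — `|∫ cos(2π m·Φ + θ) a| ≤ sup |Lᴺ a|`.

The estimate of `sup |Lᴺ a|` (the analytic half of (C.1)) is the subject of
`OnsagerBDSVStationaryPhaseBounds.lean`, and the assembly of (C.1) is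
`OnsagerBDSVStationaryPhaseProofs.lean`.

## References

* T. Buckmaster, C. De Lellis, L. Székelyhidi Jr., V. Vicol, *Onsager's conjecture for admissible
  weak solutions*, CPAM 72 (2019) = arXiv:1701.08678, App. C, Prop. C.2 (C.1). [`BuckmasterEtAl2018`]
* S. Daneri, L. Székelyhidi Jr., *Non-uniqueness and h-principle for Hölder-continuous weak
  solutions of the Euler equations*, ARMA 224 (2017) = arXiv:1603.09714, Lemma 2.2 (i) and its
  proof. [`DaneriSzekelyhidi2017`]
-/

noncomputable section

open Set MeasureTheory Complex
open scoped NNReal ENNReal ContDiff InnerProductSpace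

namespace Literature.Analysis.FluidPDE

namespace BDSV

open FunctionSpaces FunctionSpaces.Torus

/-- The flat three-torus `T³ = (ℝ/ℤ)³`, local notation. -/
local notation "𝕋³" => UnitAddTorus (Fin 3)

/-- Euclidean `ℝ³`, local notation. -/
local notation "ℝ³" => EuclideanSpace ℝ (Fin 3)

/-! ## The phase factor and its derivative -/

section PhaseFactor

/-- The complex phase factor `E = e^{iθ} e^{2πi m·Φ}` whose real part is
`BDSV.phaseCos m D θ = cos(2π m·Φ + θ)`. [cite: BuckmasterEtAl2018, App. C Prop. C.2] -/
def phaseFactor (m : Fin 3 → ℤ) (D : 𝕋³ → ℝ³) (θ : ℝ) (x : 𝕋³) : ℂ :=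
  Complex.exp ((θ : ℂ) * Complex.I) * phaseExp m D x

/-- The real phase function `Ψ(y) = θ + 2π m·y + 2π m·D̃(y)` on the cover `ℝ³`, so that the lift of
the phase factor is `e^{iΨ}`. [folklore] -/
def phaseFun (m : Fin 3 → ℤ) (D : 𝕋³ → ℝ³) (θ : ℝ) (y : ℝ³) : ℝ :=
  θ + 2 * Real.pi * ⟪latticeVec m, y⟫_ℝ + phaseArg m D (proj y)

variable (m : Fin 3 → ℤ) (D : 𝕋³ → ℝ³) (θ : ℝ)

/-- `phaseCos = Re E`. [folklore] -/
theorem phaseCos_eq_re_phaseFactor (x : 𝕋³) : phaseCos m D θ x = (phaseFactor m D θ x).re := rfl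

/-- `|E| = 1`. [folklore] -/
theorem norm_phaseFactor (x : 𝕋³) : ‖phaseFactor m D θ x‖ = 1 := by
  rw [phaseFactor, norm_mul, Complex.norm_exp_ofReal_mul_I, norm_phaseExp, one_mul]

/-- The phase factor is smooth for a smooth displacement. [folklore] -/
theorem isSmooth_phaseFactor {D : 𝕋³ → ℝ³} (hD : IsSmooth D) : IsSmooth (phaseFactor m D θ) :=
  (isSmooth_const _).mul (isSmooth_phaseExp m hD)

/-- **The lift of the phase factor is `e^{iΨ}`**: `E(proj y) = exp(i(θ + 2π m·y + 2π m·D̃(y)))`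
(the character `e_m` lifts to `y ↦ e^{2πi m·y}`). [folklore] -/
theorem lift_phaseFactor :
    lift (phaseFactor m D θ) = fun y => Complex.exp ((phaseFun m D θ y : ℂ) * Complex.I) := by
  funext y
  have hchar : UnitAddTorus.mFourier m (proj y) =
      Complex.exp (((2 * Real.pi * ⟪latticeVec m, y⟫_ℝ : ℝ) : ℂ) * Complex.I) := by
    simp only [UnitAddTorus.mFourier, ContinuousMap.coe_mk, proj_apply, fourier_coe_apply]
    rw [← Complex.exp_sum, inner_latticeVec_eq_sum]
    congr 1
    push_cast
    rw [Finset.mul_sum, Finset.sum_mul]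
    exact Finset.sum_congr rfl fun i _ => by ring
  rw [lift_apply, phaseFactor, phaseExp, hchar, ← Complex.exp_add, ← Complex.exp_add, phaseFun]
  congr 1
  push_cast
  ring

variable {m D θ}

/-- `Ψ` is differentiable with `DΨ(y) v = 2π ⟪m, v + ∇D̃(y) v⟫`. [folklore] -/
theorem hasFDerivAt_phaseFun (hD : IsSmooth D) (y : ℝ³) :
    HasFDerivAt (phaseFun m D θ)
      ((2 * Real.pi) • innerSL ℝ (latticeVec m) +
        ((2 * Real.pi) • innerSL ℝ (latticeVec m)).comp (fderiv ℝ (lift D) y)) y := by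
  set ℓ : ℝ³ →L[ℝ] ℝ := (2 * Real.pi) • innerSL ℝ (latticeVec m) with hℓ
  have hℓapp : ∀ v, ℓ v = 2 * Real.pi * ⟪latticeVec m, v⟫_ℝ := fun v => by
    simp [hℓ, innerSL_apply_apply]
  have hfun : phaseFun m D θ = fun y => θ + ℓ y + ℓ (lift D y) := by
    funext y
    rw [phaseFun, hℓapp, hℓapp, phaseArg_eq_inner, lift_apply]
  rw [hfun]
  have hDd : DifferentiableAt ℝ (lift D) y := (hD.differentiable (by simp)).differentiableAt
  exact ((hasFDerivAt_const θ y).add ℓ.hasFDerivAt).add (ℓ.hasFDerivAt.comp y hDd.hasFDerivAt)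
    |>.congr_fderiv (by rw [zero_add])

/-- `DΨ(y) v = 2π ⟪m, v + ∇D̃(y) v⟫`. [folklore] -/
theorem fderiv_phaseFun_apply (hD : IsSmooth D) (y v : ℝ³) :
    fderiv ℝ (phaseFun m D θ) y v = 2 * Real.pi * ⟪latticeVec m, v + fderiv ℝ (lift D) y v⟫_ℝ := by
  rw [(hasFDerivAt_phaseFun (θ := θ) hD y).fderiv]
  simp only [add_apply, smul_apply, ContinuousLinearMap.comp_apply, innerSL_apply_apply,
    smul_eq_mul, inner_add_right]
  ring

/-- **Derivative of the lifted phase factor**: `D(E∘proj)(y) v = E(proj y) · i · 2π⟪m, v + ∇D̃(y)v⟫`.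
[folklore] -/
theorem fderiv_lift_phaseFactor_apply (hD : IsSmooth D) (y v : ℝ³) :
    fderiv ℝ (lift (phaseFactor m D θ)) y v =
      lift (phaseFactor m D θ) y *
        (((2 * Real.pi * ⟪latticeVec m, v + fderiv ℝ (lift D) y v⟫_ℝ : ℝ) : ℂ) * Complex.I) := by
  have hΨ := hasFDerivAt_phaseFun (m := m) (θ := θ) hD y
  set L := fderiv ℝ (phaseFun m D θ) y with hL
  have hΨ' : HasFDerivAt (phaseFun m D θ) L y := hΨ.differentiableAt.hasFDerivAt
  have hf : HasFDerivAt (fun y => (phaseFun m D θ y : ℂ) * Complex.I) (L.smulRight Complex.I) y := by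
    have := hΨ'.smul_const Complex.I
    refine this.congr_of_eventuallyEq (Filter.Eventually.of_forall fun z => ?_)
    simp [Complex.real_smul]
  have hE := hf.cexp
  rw [lift_phaseFactor, hE.fderiv]
  simp only [smul_apply, ContinuousLinearMap.smulRight_apply, smul_eq_mul, Complex.real_smul]
  rw [hL, fderiv_phaseFun_apply hD]

/-- **`∂ⱼE = i (2π|m| dirVecⱼ) E`** on the torus (`dirVec = ∇(m·Φ)/|m|`). [folklore] -/
theorem partialDeriv_phaseFactor (hD : IsSmooth D) (j : Fin 3) (x : 𝕋³) :
    Torus.partialDeriv j (phaseFactor m D θ) x =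
      phaseFactor m D θ x *
        (((2 * Real.pi * ‖latticeVec m‖ * dirVec m D x j : ℝ) : ℂ) * Complex.I) := by
  obtain ⟨y, rfl⟩ := proj_surjective x
  have h1 : IsContDiff 1 (phaseFactor m D θ) := (isSmooth_phaseFactor m θ hD).isContDiff (by simp)
  rw [partialDeriv_eq_fderiv_apply h1, ← fderiv_lift, fderiv_lift_phaseFactor_apply hD,
    lift_apply, fderiv_lift, ← norm_mul_inner_dirVec, EuclideanSpace.inner_single_right]
  simp [mul_assoc]

end PhaseFactor

/-! ## The operator `L b = div(b F)` and one integration by parts -/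

section IBP

/-- **The integration-by-parts operator** `L b = ∑ⱼ ∂ⱼ (b Fⱼ) = div(b ∇φ/|∇φ|²)`
(Daneri–Székelyhidi: `aₙ = -div(aₙ₋₁∇φ/|∇φ|²)`; here without the sign, which is carried by the
factor `i` in `∫ bE = i∫ (Lb)E`). [cite: DaneriSzekelyhidi2017, Lemma 2.2 (proof)] -/
def ibpOp (m : Fin 3 → ℤ) (D : 𝕋³ → ℝ³) (b : 𝕋³ → ℝ) (x : 𝕋³) : ℝ :=
  ∑ j, Torus.partialDeriv j (fun y => b y * ibpField m D j y) x

variable {Ĉ : ℝ} {D : 𝕋³ → ℝ³} {m : Fin 3 → ℤ} {θ : ℝ}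

/-- Products of smooth real functions on the torus are smooth. [folklore] -/
theorem isSmooth_mul {f g : 𝕋³ → ℝ} (hf : IsSmooth f) (hg : IsSmooth g) :
    IsSmooth fun x => f x * g x :=
  ContDiff.mul hf hg

/-- `x ↦ (b x : ℂ) E x` is smooth for smooth real `b` and smooth complex `E`. [folklore] -/
theorem isSmooth_ofReal_mul {b : 𝕋³ → ℝ} {E : 𝕋³ → ℂ} (hb : IsSmooth b) (hE : IsSmooth E) :
    IsSmooth fun x => (b x : ℂ) * E x :=
  ContDiff.mul (Complex.ofRealCLM.contDiff.comp hb) hE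

/-- `L b` is smooth for smooth `b` (and a smooth non-degenerate displacement). [folklore] -/
theorem isSmooth_ibpOp (hĈ : 1 ≤ Ĉ) (hD : IsSmooth D) (hND : IsNondegenerateDisplacement Ĉ D)
    (hm : m ≠ 0) {b : 𝕋³ → ℝ} (hb : IsSmooth b) : IsSmooth (ibpOp m D b) := by
  have h : ∀ j, IsSmooth (Torus.partialDeriv j fun y => b y * ibpField m D j y) := fun j =>
    (isSmooth_mul hb (isSmooth_ibpField hĈ hD hND hm j)).partialDeriv j
  have hfun : lift (ibpOp m D b) =
      fun y => ∑ j, lift (Torus.partialDeriv j fun y => b y * ibpField m D j y) y := by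
    funext y
    simp only [lift_apply, ibpOp]
  unfold IsSmooth
  rw [hfun]
  exact ContDiff.sum fun j _ => h j

/-- Iterates `Lⁿ b` are smooth. [folklore] -/
theorem isSmooth_iterate_ibpOp (hĈ : 1 ≤ Ĉ) (hD : IsSmooth D)
    (hND : IsNondegenerateDisplacement Ĉ D) (hm : m ≠ 0) {b : 𝕋³ → ℝ} (hb : IsSmooth b) :
    ∀ n : ℕ, IsSmooth ((ibpOp m D)^[n] b)
  | 0 => hb
  | n + 1 => by
      rw [Function.iterate_succ_apply']
      exact isSmooth_ibpOp hĈ hD hND hm (isSmooth_iterate_ibpOp hĈ hD hND hm hb n)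

/-- The lift of `L b`: `(L b)∘proj = ∑ⱼ ∂ⱼ(b̃ F̃ⱼ)` with `b̃ = b∘proj`, `F̃ⱼ = Fⱼ∘proj` (used for the
derivative bounds). [folklore] -/
theorem lift_ibpOp (hĈ : 1 ≤ Ĉ) (hD : IsSmooth D) (hND : IsNondegenerateDisplacement Ĉ D)
    (hm : m ≠ 0) {b : 𝕋³ → ℝ} (hb : IsSmooth b) :
    lift (ibpOp m D b) = fun y => ∑ j, fderiv ℝ (fun z => lift b z * lift (ibpField m D j) z) y
      (EuclideanSpace.single j (1 : ℝ)) := by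
  funext y
  rw [lift_apply, ibpOp]
  refine Finset.sum_congr rfl fun j _ => ?_
  have h1 : IsContDiff 1 (fun z => b z * ibpField m D j z) :=
    (isSmooth_mul hb (isSmooth_ibpField hĈ hD hND hm j)).isContDiff (by simp)
  rw [partialDeriv_eq_fderiv_apply h1, ← fderiv_lift]
  rfl

/-- **One integration by parts** (the inductive step of Daneri–Székelyhidi's proof of
Lemma 2.2 (i)): for smooth real `b`, `∫ b E = i ∫ (L b) E`. Indeed
`0 = ∑ⱼ ∫ ∂ⱼ(b Fⱼ E) = ∫ (L b) E + ∫ b (∑ⱼ Fⱼ ∂ⱼE) = ∫ (Lb) E + i ∫ b E`, because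
`∑ⱼ Fⱼ ∂ⱼ E = i (F·∇φ) E = i E`. [cite: DaneriSzekelyhidi2017, Lemma 2.2 (proof)] -/
theorem integral_mul_phaseFactor (hĈ : 1 ≤ Ĉ) (hD : IsSmooth D)
    (hND : IsNondegenerateDisplacement Ĉ D) (hm : m ≠ 0) {b : 𝕋³ → ℝ} (hb : IsSmooth b) :
    ∫ x, (b x : ℂ) * phaseFactor m D θ x =
      Complex.I * ∫ x, (ibpOp m D b x : ℂ) * phaseFactor m D θ x := by
  set E := phaseFactor m D θ with hE
  have hEs : IsSmooth E := isSmooth_phaseFactor m θ hD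
  set p : Fin 3 → 𝕋³ → ℝ := fun j y => b y * ibpField m D j y with hp
  have hps : ∀ j, IsSmooth (p j) := fun j => isSmooth_mul hb (isSmooth_ibpField hĈ hD hND hm j)
  -- `hⱼ = pⱼ • E`, smooth, with `∫ ∂ⱼ hⱼ = 0`
  set h : Fin 3 → 𝕋³ → ℂ := fun j y => p j y • E y with hh
  have hhs : ∀ j, IsSmooth (h j) := fun j => (hps j).smul' hEs
  have hzero : ∀ j, ∫ x, Torus.partialDeriv j (h j) x = 0 := fun j =>
    integral_partialDeriv_eq_zero_holds (hhs j) j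
  -- the product rule and `∂ⱼE = i c uⱼ E`
  have hprod : ∀ j x, Torus.partialDeriv j (h j) x =
      ((p j x * (2 * Real.pi * ‖latticeVec m‖ * dirVec m D x j) : ℝ) : ℂ) * (E x * Complex.I) +
        ((Torus.partialDeriv j (p j) x : ℝ) : ℂ) * E x := by
    intro j x
    rw [hh, partialDeriv_smul ((hps j).isContDiff (by simp)) (hEs.isContDiff (by simp)) j x,
      hE, partialDeriv_phaseFactor hD j x, ← hE, Complex.real_smul, Complex.real_smul]
    push_cast
    ring
  -- sum over `j`
  have hsum : ∀ x, ∑ j, Torus.partialDeriv j (h j) x =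
      (b x : ℂ) * E x * Complex.I + (ibpOp m D b x : ℂ) * E x := by
    intro x
    simp only [hprod, Finset.sum_add_distrib, ← Finset.sum_mul]
    congr 1
    · rw [← mul_assoc]
      congr 1
      have hkey := sum_ibpField_mul (D := D) hm (dirVec_ne_zero hĈ hND hm x)
      have : ∑ j, p j x * (2 * Real.pi * ‖latticeVec m‖ * dirVec m D x j) = b x := by
        simp only [hp, mul_assoc]
        rw [← Finset.mul_sum]
        simp only [← mul_assoc] at hkey ⊢
        rw [hkey, mul_one]
      rw [← this]
      push_cast
      rfl
    · rw [ibpOp]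
      push_cast
      rfl
  -- integrate
  have hint : ∀ j, Integrable (fun x => Torus.partialDeriv j (h j) x) :=
    fun j => ((hhs j).partialDeriv j).integrable
  have htot : ∫ x, ∑ j, Torus.partialDeriv j (h j) x = 0 := by
    rw [integral_finsetSum _ fun j _ => hint j]
    exact Finset.sum_eq_zero fun j _ => hzero j
  simp only [hsum] at htot
  have hi1' : IsSmooth fun x => (b x : ℂ) * E x * Complex.I :=
    ContDiff.mul (isSmooth_ofReal_mul hb hEs) (isSmooth_const _)
  have hi1 : Integrable fun x => (b x : ℂ) * E x * Complex.I := hi1'.integrable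
  have hi2 : Integrable fun x => (ibpOp m D b x : ℂ) * E x :=
    (isSmooth_ofReal_mul (isSmooth_ibpOp hĈ hD hND hm hb) hEs).integrable
  rw [integral_add hi1 hi2, integral_mul_const] at htot
  -- `(∫ bE) I + ∫ (Lb)E = 0`
  linear_combination (-Complex.I) * htot + (∫ x, (b x : ℂ) * E x) * Complex.I_sq

/-- **`N` integrations by parts**: `‖∫ a E‖ = ‖∫ (Lⁿ a) E‖` for every `n` (each step costs a
factor `i`). [cite: DaneriSzekelyhidi2017, Lemma 2.2 (proof)] -/
theorem norm_integral_mul_phaseFactor_eq_iterate (hĈ : 1 ≤ Ĉ) (hD : IsSmooth D)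
    (hND : IsNondegenerateDisplacement Ĉ D) (hm : m ≠ 0) {a : 𝕋³ → ℝ} (ha : IsSmooth a) :
    ∀ n : ℕ, ‖∫ x, (a x : ℂ) * phaseFactor m D θ x‖ =
      ‖∫ x, ((ibpOp m D)^[n] a x : ℂ) * phaseFactor m D θ x‖
  | 0 => rfl
  | n + 1 => by
      rw [norm_integral_mul_phaseFactor_eq_iterate hĈ hD hND hm ha n,
        integral_mul_phaseFactor hĈ hD hND hm (isSmooth_iterate_ibpOp hĈ hD hND hm ha n),
        norm_mul, Complex.norm_I, one_mul, Function.iterate_succ_apply']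

/-- **Reduction of (C.1) to a sup bound**: `|∫ cos(2π m·Φ + θ) a| ≤ M` as soon as
`|Lᴺ a| ≤ M` pointwise (`∫ cos(…) a = Re ∫ a E`, `‖∫ aE‖ = ‖∫ (Lᴺa)E‖ ≤ sup|Lᴺ a|`, the torus
having measure one). [cite: BuckmasterEtAl2018, App. C Prop. C.2 (C.1)] -/
theorem norm_integral_phaseCos_mul_le (hĈ : 1 ≤ Ĉ) (hD : IsSmooth D)
    (hND : IsNondegenerateDisplacement Ĉ D) (hm : m ≠ 0) (θ : ℝ) {a : 𝕋³ → ℝ} (ha : IsSmooth a)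
    (N : ℕ) {M : ℝ} (hM : ∀ x, |(ibpOp m D)^[N] a x| ≤ M) :
    ‖∫ x, phaseCos m D θ x * a x‖ ≤ M := by
  set E := phaseFactor m D θ with hE
  have hEs : IsSmooth E := isSmooth_phaseFactor m θ hD
  have hre : (fun x => phaseCos m D θ x * a x) = fun x => Complex.reCLM ((a x : ℂ) * E x) := by
    funext x
    rw [Complex.reCLM_apply, Complex.re_ofReal_mul, phaseCos_eq_re_phaseFactor, mul_comm]
  have hint : Integrable fun x => (a x : ℂ) * E x := (isSmooth_ofReal_mul ha hEs).integrable
  rw [hre, Complex.reCLM.integral_comp_comm hint, Complex.reCLM_apply, Real.norm_eq_abs]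
  refine (Complex.abs_re_le_norm _).trans ?_
  rw [hE, norm_integral_mul_phaseFactor_eq_iterate hĈ hD hND hm ha N]
  have hb : ∀ x, ‖((ibpOp m D)^[N] a x : ℂ) * phaseFactor m D θ x‖ ≤ M := fun x => by
    rw [norm_mul, norm_phaseFactor, mul_one, Complex.norm_real, Real.norm_eq_abs]
    exact hM x
  have h := norm_integral_le_of_norm_le_const (μ := volume) (Filter.Eventually.of_forall hb)
  rwa [probReal_univ, mul_one] at h

end IBP

end BDSV

end Literature.Analysis.FluidPDE
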